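import Summits.AtomisticToContinuum.Crystallization.Theorems.ChargedEnergyGapBlockCharging
import Summits.AtomisticToContinuum.Crystallization.Theorems.ChargedEnergyGapPassage
import HarnessLib

/-!
# Charged energy gap — lens-3 g65, node «BarlowRef» (R3) — part 28a «MemberValues»: the pointwise budget of a block member

Line `stmt-AtomisticToContinuum-14231`, item 4 of the residual of record (the tube block EXHIBITION, part 25).  This part is the POINTWISE
half of the exhibition: what a single block member pays.

* §1 the smooth step is MONOTONE (derivative `140 s³(1 − s)³ ≥ 0`), `smoothStep (1/2) = 1/2`, hence the profile weight is `≥ 1/16` beyond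
  three quarters of the profile radius (`3ϱ/4 ≤ dist(q, C)`);
* §2 CLEARANCE THRESHOLDS `ClearOf ϱχ D σ a b c` («`dist(c, Dᵢ) ≥ a` where `σᵢ`, `≤ b` where `¬σᵢ`»): Lipschitz transport to nearby points,
  and for `a > ϱχ/2`, `b < ϱχ` every listed factor is positive, so `χ_σ(c) > 0`, `alive_σ(c) = 1`, and `c` PAYS once `dist(c, C) > ϱ/2`;
* §3 ★ THE MEMBER VALUE: a non-excised member with positive factors, level `≥ 3ϱ/4`, and EITHER level `< ϱ` OR some listed set in transition
  has `chargeBudget ≥ min B_T (B_χ/16)`; an excised member with a paying site within `3ϱ/8` has `chargeBudget = … ≥ B_H`; paying sites near a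
  member keep every far target at distance `≥ 3ϱ/8 − δ`;
* §4 RECORD: at `(ϱχ, ϱ, B_T, B_χ) = (80, 160, 1/2100, 1/46)` a non-excised member pays `≥ 1` per unit of the uncored rate `θ_U = 1/2100`
  (part 26e band `U`), and with `B_H = 5·10⁷ · 61³` an excised near member pays `≥ #(P.points ∩ B̄(q, 18))` per unit of `θ_H = 5·10⁷`.

ELEMENTARY · PROVED, 0 sorry.
-/

noncomputable section

open scoped Classical

open Literature.MathematicalPhysics.StatisticalMechanics Literature.Geometry.DiscreteGeometry
open Summit.AtomisticToContinuum.Crystallization.Theses.PricedLinkCensus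
open Summit.AtomisticToContinuum.Crystallization.Theorems.ChargedEnergyGapNegative

namespace Summit.AtomisticToContinuum.Crystallization.Theorems.ChargedEnergyGapChartDial

/-! ## §1 Monotone smooth step; the profile weight beyond three quarters -/

section SmoothStepMono

/-- The polynomial core `s ↦ s⁴(35 − 84s + 70s² − 20s³)` of the smooth step is monotone on `[0, 1]` (derivative `140 s³ (1 − s)³`). -/
theorem smoothStepPoly_monotoneOn :
    MonotoneOn (fun s : ℝ => s ^ 4 * (35 - 84 * s + 70 * s ^ 2 - 20 * s ^ 3)) (Set.Icc 0 1) := by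
  have hderiv : ∀ s : ℝ, HasDerivAt (fun s : ℝ => s ^ 4 * (35 - 84 * s + 70 * s ^ 2 - 20 * s ^ 3))
      (4 * s ^ 3 * (35 - 84 * s + 70 * s ^ 2 - 20 * s ^ 3) + s ^ 4 * (0 - 84 * 1 + 70 * (2 * s) - 20 * (3 * s ^ 2))) s := by
    intro s
    have hid : HasDerivAt (fun s : ℝ => s) 1 s := hasDerivAt_id s
    have hp2 : HasDerivAt (fun s : ℝ => s ^ 2) (2 * s) s := by simpa using hasDerivAt_pow 2 s
    have hp3 : HasDerivAt (fun s : ℝ => s ^ 3) (3 * s ^ 2) s := by simpa using hasDerivAt_pow 3 s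
    have hp4 : HasDerivAt (fun s : ℝ => s ^ 4) (4 * s ^ 3) s := by simpa using hasDerivAt_pow 4 s
    have h2 := (((hasDerivAt_const s (35 : ℝ)).sub (hid.const_mul 84)).add (hp2.const_mul 70)).sub (hp3.const_mul 20)
    exact hp4.mul h2
  refine monotoneOn_of_deriv_nonneg (convex_Icc 0 1) ?_ ?_ ?_
  · exact HasDerivAt.continuousOn fun s _ => hderiv s
  · exact fun s _ => (hderiv s).differentiableAt.differentiableWithinAt
  · intro s hs
    rw [interior_Icc] at hs
    rw [(hderiv s).deriv]
    have h0 : 0 ≤ s := hs.1.le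
    have h1 : 0 ≤ 1 - s := by linarith [hs.2]
    have h : 4 * s ^ 3 * (35 - 84 * s + 70 * s ^ 2 - 20 * s ^ 3) + s ^ 4 * (0 - 84 * 1 + 70 * (2 * s) - 20 * (3 * s ^ 2)) =
        140 * (s ^ 3 * (1 - s) ^ 3) := by ring
    rw [h]
    positivity

/-- ★ The smooth step is monotone. -/
theorem smoothStep_mono {t₁ t₂ : ℝ} (h : t₁ ≤ t₂) : smoothStep t₁ ≤ smoothStep t₂ := by
  have h1 := clamp_mem t₁
  have h2 := clamp_mem t₂
  have hle : max 0 (min 1 t₁) ≤ max 0 (min 1 t₂) := max_le_max le_rfl (min_le_min le_rfl h)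
  exact smoothStepPoly_monotoneOn ⟨h1.1, h1.2⟩ ⟨h2.1, h2.2⟩ hle

/-- `smoothStep (1/2) = 1/2`. -/
theorem smoothStep_half : smoothStep (1 / 2) = 1 / 2 := by
  have h : max (0 : ℝ) (min 1 (1 / 2)) = 1 / 2 := by norm_num
  rw [smoothStep, h]
  norm_num

/-- ★ Beyond three quarters of the profile radius the weight is at least `1/16`: `3ϱ/4 ≤ dist(q, C) ⟹ 1/16 ≤ w(q)`. -/
theorem profileWeight_ge_sixteenth {ϱ : ℝ} (hϱ : 0 < ϱ) {C : Set E3} {q : E3} (h : 3 * ϱ / 4 ≤ Metric.infDist q C) :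
    1 / 16 ≤ profileWeight ϱ C q := by
  have ht : 2 - 2 * Metric.infDist q C / ϱ ≤ 1 / 2 := by
    have h1 : 3 / 2 ≤ 2 * Metric.infDist q C / ϱ := by rw [le_div_iff₀ hϱ]; linarith
    linarith
  have hS : smoothStep (2 - 2 * Metric.infDist q C / ϱ) ≤ 1 / 2 := (smoothStep_mono ht).trans_eq smoothStep_half
  have h2 : (1 / 2 : ℝ) ≤ 1 - smoothStep (2 - 2 * Metric.infDist q C / ϱ) := by linarith
  have h4 := pow_le_pow_left₀ (by norm_num) h2 4
  unfold profileWeight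
  linarith [show ((1 / 2 : ℝ)) ^ 4 = 1 / 16 by norm_num]

end SmoothStepMono

/-! ## §2 Clearance thresholds from the listed sets -/

section Clear

variable (ϱχ : ℝ) {m : ℕ} (D : Fin m → Set E3) (σ : Fin m → Bool)

/-- CLEARANCE THRESHOLDS at `c`: `dist(c, Dᵢ) ≥ a` for the sets with `σᵢ = true` («far from `Dᵢ`») and `dist(c, Dᵢ) ≤ b` for those with
`σᵢ = false` («near `Dᵢ`»).  Paying territory of the pattern `σ` is `a > ϱχ/2`, `b < ϱχ`. -/
def ClearOf (a b : ℝ) (c : E3) : Prop :=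
  ∀ i, (σ i = true → a ≤ Metric.infDist c (D i)) ∧ (σ i = false → Metric.infDist c (D i) ≤ b)

variable {ϱχ D σ}

/-- Thresholds weaken monotonically. [formal bookkeeping] -/
theorem ClearOf.mono {a b a' b' : ℝ} {c : E3} (h : ClearOf D σ a b c) (ha : a' ≤ a) (hb : b ≤ b') : ClearOf D σ a' b' c :=
  fun i => ⟨fun hi => ha.trans ((h i).1 hi), fun hi => ((h i).2 hi).trans hb⟩

/-- LIPSCHITZ TRANSPORT: thresholds `(a, b)` at `p` give `(a − δ, b + δ)` at every `c` with `dist c p ≤ δ`. -/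
theorem ClearOf.of_dist_le {a b δ : ℝ} {p c : E3} (h : ClearOf D σ a b p) (hd : dist c p ≤ δ) : ClearOf D σ (a - δ) (b + δ) c := by
  intro i
  have h1 : Metric.infDist p (D i) ≤ Metric.infDist c (D i) + dist p c := Metric.infDist_le_infDist_add_dist
  have h2 : Metric.infDist c (D i) ≤ Metric.infDist p (D i) + dist c p := Metric.infDist_le_infDist_add_dist
  rw [dist_comm] at h1
  exact ⟨fun hi => by linarith [(h i).1 hi], fun hi => by linarith [(h i).2 hi]⟩

/-- In paying territory every listed factor is POSITIVE. -/
theorem ClearOf.factor_pos (hϱχ : 0 < ϱχ) {a b : ℝ} (ha : ϱχ / 2 < a) (hb : b < ϱχ) {c : E3} (h : ClearOf D σ a b c) (i : Fin m) :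
    0 < (if σ i then profileWeight ϱχ (D i) c else 1 - profileWeight ϱχ (D i) c) := by
  by_cases hi : σ i = true
  · rw [if_pos hi]
    exact profileWeight_pos_of_lt_infDist hϱχ (ha.trans_le ((h i).1 hi))
  · rw [if_neg hi]
    have hi' : σ i = false := by simpa using hi
    exact sub_pos.2 (profileWeight_lt_one_of_infDist_lt hϱχ (((h i).2 hi').trans_lt hb))

/-- … hence the pattern weight is positive, … -/
theorem ClearOf.localFactor_pos (hϱχ : 0 < ϱχ) {a b : ℝ} (ha : ϱχ / 2 < a) (hb : b < ϱχ) {c : E3} (h : ClearOf D σ a b c) :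
    0 < localFactor ϱχ D σ c := by
  unfold localFactor
  exact Finset.prod_pos fun i _ => h.factor_pos hϱχ ha hb i

/-- … the alive indicator is `1`, … -/
theorem ClearOf.aliveFactor_eq_one (hϱχ : 0 < ϱχ) {a b : ℝ} (ha : ϱχ / 2 < a) (hb : b < ϱχ) {c : E3} (h : ClearOf D σ a b c) :
    aliveFactor ϱχ D σ c = 1 :=
  aliveFactor_eq_one_of_pos fun i => h.factor_pos hϱχ ha hb i

/-- … and beyond half the profile radius the site PAYS: `χ_σ(c)·w(c) > 0`. -/
theorem ClearOf.paying (hϱχ : 0 < ϱχ) {a b : ℝ} (ha : ϱχ / 2 < a) (hb : b < ϱχ) {c : E3} (h : ClearOf D σ a b c) {ϱ : ℝ} (hϱ : 0 < ϱ)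
    {C : Set E3} (hL : ϱ / 2 < Metric.infDist c C) : 0 < localFactor ϱχ D σ c * profileWeight ϱ C c :=
  mul_pos (h.localFactor_pos hϱχ ha hb) (profileWeight_pos_of_lt_infDist hϱ hL)

/-- A listed set at distance strictly between `ϱχ/2` and `ϱχ` is IN TRANSITION, … -/
theorem inTransition_of_dist (hϱχ : 0 < ϱχ) {i : Fin m} {c : E3} (h1 : ϱχ / 2 < Metric.infDist c (D i)) (h2 : Metric.infDist c (D i) < ϱχ) :
    InTransition ϱχ D i c :=
  ⟨profileWeight_pos_of_lt_infDist hϱχ h1, profileWeight_lt_one_of_infDist_lt hϱχ h2⟩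

/-- … so the transition multiplicity is at least `1`. -/
theorem one_le_transMult_of_inTransition {i : Fin m} {c : E3} (h : InTransition ϱχ D i c) : 1 ≤ transMult ϱχ D c :=
  Finset.card_pos.2 ⟨i, Finset.mem_filter.2 ⟨Finset.mem_univ _, h⟩⟩

/-- A BULK SOURCE sits in deep paying territory: thresholds `(ϱχ, ϱχ/2)` — each factor is positive and not in transition, hence `= 1`. -/
theorem ClearOf.of_isBulkSource (hϱχ : 0 < ϱχ) {X : Set E3} {ϱ : ℝ} {C : Set E3} {y : E3} (hy : IsBulkSource ϱχ D σ X ϱ C y) :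
    ClearOf D σ ϱχ (ϱχ / 2) y := by
  obtain ⟨-, -, hmult, hχ⟩ := hy
  have hnt : ∀ i, ¬ InTransition ϱχ D i y := by
    intro i hi
    unfold transMult at hmult
    rw [Finset.card_eq_zero, Finset.filter_eq_empty_iff] at hmult
    exact hmult (Finset.mem_univ i) hi
  intro i
  have hfac : 0 < (if σ i then profileWeight ϱχ (D i) y else 1 - profileWeight ϱχ (D i) y) :=
    lt_of_lt_of_le hχ (localFactor_le_listFactor (ϱχ := ϱχ) (D := D) (σ := σ) i y)
  have h1 : (if σ i then profileWeight ϱχ (D i) y else 1 - profileWeight ϱχ (D i) y) = 1 :=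
    (factor_eq_zero_or_one_of_not_inTransition (σ := σ) (hnt i)).resolve_left hfac.ne'
  refine ⟨fun hi => ?_, fun hi => ?_⟩
  · rw [if_pos hi] at h1
    exact le_infDist_of_profileWeight_eq_one hϱχ h1
  · have hi' : ¬ (σ i = true) := by simp [hi]
    rw [if_neg hi'] at h1
    exact infDist_le_of_profileWeight_eq_zero hϱχ (by linarith)

end Clear

/-! ## §3 The member values -/

section Member

variable {ϱχ : ℝ} {m : ℕ} {D : Fin m → Set E3} {σ : Fin m → Bool} {P : PeriodicConfiguration 3} {X : Set E3} {ϱ : ℝ} {C : Set E3}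

/-- ★ **THE NON-EXCISED MEMBER VALUE.**  `c ∉ X` in paying territory (`ClearOf a b`, `a > ϱχ/2`, `b < ϱχ`), at level `≥ 3ϱ/4`, and EITHER in the
shell (level `< ϱ`) OR with some listed set in transition: `chargeBudget c ≥ min B_T (B_χ/16)` — the shell term pays `B_T·χ_σ(c) = B_T` when no set
is in transition, the transition term pays `B_χ·w(c)·1·mult² ≥ B_χ/16` otherwise. -/
theorem chargeBudget_ge_min_of_member (hϱχ : 0 < ϱχ) (hϱ : 0 < ϱ) {a b B_T B_χ B_H : ℝ} (ha : ϱχ / 2 < a) (hb : b < ϱχ) (hBT : 0 ≤ B_T)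
    (hBχ : 0 ≤ B_χ) (hBH : 0 ≤ B_H) {c : E3} (hcX : c ∉ X) (hcl : ClearOf D σ a b c) (hL : 3 * ϱ / 4 ≤ Metric.infDist c C)
    (hor : Metric.infDist c C < ϱ ∨ 1 ≤ transMult ϱχ D c) :
    min B_T (B_χ / 16) ≤ chargeBudget ϱχ D σ P X ϱ C B_T B_χ B_H c := by
  have hpos := fun i => hcl.factor_pos hϱχ ha hb i
  have hw0 : 0 < profileWeight ϱ C c := profileWeight_pos_of_lt_infDist hϱ (by linarith)
  have hw16 : 1 / 16 ≤ profileWeight ϱ C c := profileWeight_ge_sixteenth hϱ hL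
  have halive : aliveFactor ϱχ D σ c = 1 := hcl.aliveFactor_eq_one hϱχ ha hb
  have h1 : 0 ≤ B_T * (if c ∉ X ∧ 0 < profileWeight ϱ C c ∧ profileWeight ϱ C c < 1 then localFactor ϱχ D σ c else 0) := by
    refine mul_nonneg hBT ?_
    split_ifs
    · exact localFactor_nonneg (ϱχ := ϱχ) (D := D) (σ := σ) c
    · exact le_rfl
  have h2 : 0 ≤ B_χ * (if c ∈ X then 0 else profileWeight ϱ C c * aliveFactor ϱχ D σ c * (transMult ϱχ D c : ℝ) ^ 2) := by
    refine mul_nonneg hBχ ?_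
    rw [if_neg hcX, halive, mul_one]
    positivity
  have h3 : 0 ≤ B_H * (if c ∈ X ∩ nearZone ϱχ D σ P X ϱ C then (1 : ℝ) else 0) := by
    refine mul_nonneg hBH ?_
    split_ifs <;> norm_num
  unfold chargeBudget
  by_cases hmult : transMult ϱχ D c = 0
  · -- no set in transition: the shell term pays `B_T`
    have hLϱ : Metric.infDist c C < ϱ := hor.resolve_right (by omega)
    have hw1 : profileWeight ϱ C c < 1 := profileWeight_lt_one_of_infDist_lt hϱ hLϱ
    have hχ : localFactor ϱχ D σ c = 1 := localFactor_eq_one_of_pos_of_transMult_eq_zero hpos hmult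
    rw [if_pos ⟨hcX, hw0, hw1⟩, hχ, mul_one]
    calc min B_T (B_χ / 16) ≤ B_T := min_le_left _ _
      _ ≤ _ := by linarith
  · -- a set in transition: the transition term pays `≥ B_χ/16`
    have hm1 : (1 : ℝ) ≤ (transMult ϱχ D c : ℝ) := by exact_mod_cast Nat.one_le_iff_ne_zero.2 hmult
    have hterm : B_χ / 16 ≤ B_χ * (if c ∈ X then 0 else profileWeight ϱ C c * aliveFactor ϱχ D σ c * (transMult ϱχ D c : ℝ) ^ 2) := by
      rw [if_neg hcX, halive, mul_one]
      have hsq : (1 : ℝ) ≤ (transMult ϱχ D c : ℝ) ^ 2 := by nlinarith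
      have : 1 / 16 ≤ profileWeight ϱ C c * (transMult ϱχ D c : ℝ) ^ 2 := by nlinarith
      nlinarith
    calc min B_T (B_χ / 16) ≤ B_χ / 16 := min_le_right _ _
      _ ≤ _ := by linarith

/-- A site within `3ϱ/8` of a PAYING site of `P` lies in the near zone. [definition chase] -/
theorem mem_nearZone_of_paying {q c : E3} (hq : q ∈ P.points) (hqX : q ∉ X) (hpay : 0 < localFactor ϱχ D σ q * profileWeight ϱ C q)
    (hd : dist c q < 3 * ϱ / 8) : c ∈ nearZone ϱχ D σ P X ϱ C :=
  ⟨q, hq, hqX, hpay, hd⟩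

/-- ★ **THE EXCISED MEMBER VALUE**: an excised site in the near zone has `chargeBudget = B_H`. -/
theorem chargeBudget_of_excised_near (B_T B_χ B_H : ℝ) {c : E3} (hcX : c ∈ X) (hcn : c ∈ nearZone ϱχ D σ P X ϱ C) :
    chargeBudget ϱχ D σ P X ϱ C B_T B_χ B_H c = B_H := by
  unfold chargeBudget
  rw [if_neg (fun h => h.1 hcX), if_pos hcX, if_pos ⟨hcX, hcn⟩]
  ring

/-- ★ **CLEARANCE FROM A NEARBY PAYING SITE**: if a paying site `q` of `P` lies within `δ` of `c`, every far target keeps distance `≥ 3ϱ/8 − δ`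
from `c` (a far target has no paying site within `3ϱ/8`). -/
theorem IsFarTarget.le_dist_of_paying {q c z : E3} (hq : q ∈ P.points) (hqX : q ∉ X)
    (hpay : 0 < localFactor ϱχ D σ q * profileWeight ϱ C q) {δ : ℝ} (hd : dist q c ≤ δ) (hz : IsFarTarget ϱχ D σ P X ϱ C z) :
    3 * ϱ / 8 - δ ≤ dist z c := by
  have hzn : z ∉ nearZone ϱχ D σ P X ϱ C := hz.2
  have h1 : ¬ dist z q < 3 * ϱ / 8 := fun h => hzn ⟨q, hq, hqX, hpay, h⟩
  rw [not_lt] at h1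
  have h2 : dist z q ≤ dist z c + dist c q := dist_triangle _ _ _
  rw [dist_comm c q] at h2
  linarith

/-- In particular a PAYING site keeps every far target at distance `≥ 3ϱ/8`. -/
theorem IsFarTarget.le_dist_of_paying_self {c z : E3} (hc : c ∈ P.points) (hcX : c ∉ X)
    (hpay : 0 < localFactor ϱχ D σ c * profileWeight ϱ C c) (hz : IsFarTarget ϱχ D σ P X ϱ C z) : 3 * ϱ / 8 ≤ dist z c := by
  have h := hz.le_dist_of_paying hc hcX hpay (δ := 0) (by rw [dist_self])
  linarith

end Member

/-! ## §4 Record instances -/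

section Record

variable {m : ℕ} {D : Fin m → Set E3} {σ : Fin m → Bool} {P : PeriodicConfiguration 3} {X C : Set E3}

/-- ★ RECORD NON-EXCISED MEMBER: at `(ϱχ, ϱ, B_T, B_χ) = (80, 160, 1/2100, 1/46)` a non-excised member in paying territory `(a, b)` with
`40 < a`, `b < 80`, level `≥ 120`, and level `< 160` or a set in transition, pays `≥ 1` per unit of the uncored rate `θ_U = 1/2100`. -/
theorem one_le_chargeBudget_div_record {a b B_H : ℝ} (ha : 40 < a) (hb : b < 80) (hBH : 0 ≤ B_H) {c : E3} (hcX : c ∉ X)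
    (hcl : ClearOf D σ a b c) (hL : 120 ≤ Metric.infDist c C) (hor : Metric.infDist c C < 160 ∨ 1 ≤ transMult 80 D c) :
    1 ≤ chargeBudget 80 D σ P X 160 C (1 / 2100) (1 / 46) B_H c / (1 / 2100) := by
  have h := chargeBudget_ge_min_of_member (P := P) (X := X) (by norm_num : (0 : ℝ) < 80) (by norm_num : (0 : ℝ) < 160)
    (by linarith : (80 : ℝ) / 2 < a) hb (by norm_num : (0 : ℝ) ≤ 1 / 2100) (by norm_num : (0 : ℝ) ≤ 1 / 46) hBH hcX hcl (by linarith) hor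
  rw [le_div_iff₀ (by norm_num), one_mul]
  exact le_trans (by norm_num) h

/-- ★ RECORD EXCISED MEMBER: with `B_H = 5·10⁷ · 226981` an excised near-zone member pays, per unit of the hole rate `θ_H = 5·10⁷`, at least the
point count of ANY radius-`18` ball of a `3/5`-separated reference (`≤ 61³ = 226981`). -/
theorem ncard_le_chargeBudget_div_record (hsep : IsSeparatedRef (3 / 5) P) {c : E3} (hcX : c ∈ X) (hcn : c ∈ nearZone 80 D σ P X 160 C)
    (q : E3) : ((P.points ∩ Metric.closedBall q 18).ncard : ℝ) ≤
      chargeBudget 80 D σ P X 160 C (1 / 2100) (1 / 46) (50000000 * 226981) c / 50000000 := by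
  rw [chargeBudget_of_excised_near _ _ _ hcX hcn]
  have h := hsep.ncard_inter_closedBall_le (by norm_num) (by norm_num : (0 : ℝ) ≤ 18) q
  have h2 : ((2 * 18 + 3 / 5) / (3 / 5) : ℝ) ^ 3 = 226981 := by norm_num
  rw [h2] at h
  linarith

end Record

end Summit.AtomisticToContinuum.Crystallization.Theorems.ChargedEnergyGapChartDial

end
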